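import Summits.QuantumFields.BalabanUV.T4Continuum.Spine.NE1p.DressedSmallFieldPencil

/-!
# T⁴ programme, spine estimate NE1′ (node O3b/H2) — THE TABLE-STRENGTH PENCIL CARRIES THE INDUCTION: the observable-attached
# part of the dressed small-field output is LINEAR in the attached table's (2.38)-slope under print's clause at the doubled
# constant, hence the attached sizes REPRODUCE step by step with one factor θ < 1 and the SAME source window — μ-UNIFORMITY
# (R-t4r2-Q2) of the small-field half without any charge on the source-analyticity radius — AT THE LEVEL OF THE BOOKKEEPING:
# one step (§2) + induction arithmetic (§3), modulo (B1)∕(B3)∕(B4)∕(B5) at every step with a K-free per-unit constant C′ and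
# the step-link READING (v1.1); R-t4r2-Q2 is NOT thereby met for NE1′

Cell `pub-balaban`, sub-cell `t4`, BINDER-OWNERS row NE1′; owner lineage t4-ne1p-p1 (PROVER seat P1, «RG-trajectory comparison …
μ-uniformity through the printed small-field bounds»), generation 26; ADDITIVE — imports N0j `Spine/NE1p/DressedSmallFieldPencil`
(p220020) ONLY; THEOREMS ONLY.

WHY THIS FILE.  N0j offers TWO pencils for the attached part `E[𝐕_k + 𝐖] − E[𝐕_k]` of the dressed output (`𝐖 = 𝐖_k(μ)` the
observable-attached table at source `μ`): the SOURCE pencil `z ↦ act(z·μ)` (`muPart_locE_le`: bound `M·μ₀/(μ₁ − μ₀)` with `M`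
the WHOLE envelope ∝ E₀ + D₀ — it charges the undressed size E₀ against the source window, so iterating it step by step would
shrink the admissible window with the number of steps, the phenomenon this lineage typed in `T4TrajectoryDensityDressedLoop` §8
`size_lb_noContraction`) and the STRENGTH pencil `s ↦ 𝐕_k + s·𝐖` (`regenPart_locE_le`: bound `M(ϱ)/(ϱ − 1)` at strength radius
`ϱ`).  Print's Lemma 3 constant is LINEAR in the table size ([Balaban1988RGII] p. 20 «C₃ = 2(L + 2)⁴O(1)2E₀C₁α₄⁻¹α₆⁻¹M^q exp
C₂κ₁» ∝ E₀; (2.38) «|H(Z)| ≤ C₃ε₁ exp(−(1 − 8δ)½Lκd_{k+1}(Z))» — LOCI, TYPE only), so along the strength pencil the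
(2.38)-constant is AFFINE in the radius: `A(ϱ) = A₀ + ϱ·A₁`, intercept `A₀ ∝ ε₁E₀` (undressed), slope `A₁ ∝ ε₁‖𝐖‖` (attached).
Choosing the radius as large as the intercept-to-slope ratio (`ϱ ≥ max(2, A₀/A₁)`, admissible while print's clause holds at
`A(ϱ) ≤ 2·max(A₀, 2A₁)`: «ε₁ sufficiently small» with the constant DOUBLED, as in `T4ActivityLipschitz` §1's doubled majorant)
makes the intercept leak `A₀/ϱ ≤ A₁`, whence:
* §1 `affine_div_le` [arith] — `(A₀ + ϱA₁)/(ϱ − 1) ≤ 4A₁` for `ϱ ≥ 2`, `A₀ ≤ ϱA₁`.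
* §2 `attachedPart_locE_le` (kernel; `regenPart_locE_le` BY NAME + §1) — under B13's geometry, the clauses at `A₀ + ϱA₁`,
  (E1)∕(E2) along the strength pencil and the affine (2.38)-shape majorant (`hL3`, the binder (B3) = GAPS G-ne9p2-5 read with
  its printed E₀-linearity): `‖E[𝐕_k + 𝐖](X) − E[𝐕_k](X)‖ ≤ 4·(e ν c₁ K₀²)·A₁·e^{−r₁ d(X)}` — LINEAR IN THE SLOPE, i.e. in the
  attached table's size, with (2.41)'s decay, at EVERY source `μ` of the ORIGINAL disc (no window consumed; holomorphy in `μ` on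
  the whole disc is N0j §2 `differentiableOn_locE_of_majorant`).
* §3 `attachedSize_reproduces` [arith] — with `A₁ = C′·D₀` (`C′` = the (2.38)-constant per unit of attached table size, printed
  TYPE `C₃ε₁/E₀`; `D₀` = the attached size) and the clause `4(e ν c₁ K₀²)·C′ ≤ θ`: attached part `≤ θ·D₀·e^{−r₁ d(X)}` — the
  D-terms' (1.18)-type size REPRODUCES with the factor `θ` exactly as print reproduces E₀ with ½ (p. 21 «O(1)C₃ε₁ ≤ ½E₀»);
  `attachedSize_uniform` [arith] — `D(k+1) ≤ θ·D(k)`, `θ ≤ 1` ⇒ `D(k) ≤ D(0)` for EVERY `k`: K-UNIFORM, μ-UNIFORM (the source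
  window `μ₁` is the same at every step because the strength pencil never reads it).
So for the small-field half the order of quantifiers of R-t4r2-Q2 («the constants precede ∀μ ∀K») is met AT THE LEVEL OF THE
BOOKKEEPING (modulo the binders below, which are themselves K- and μ-free statements): the constants are `θ = 4eνc₁K₀²·C′` and
the initial attached size `D(0) = μ₁·b` (first dressed step, N0k `muPart_locE_le_of_linearDressing`), both K-free; what is NOT
decided here is the binder list (B1)∕(B3)∕(B4)∕(B5) of N0j∕N0k (unchanged) with (B3) now read together with its printed
E₀-LINEARITY (the affine form of `hL3` — for Bałaban's own table the linearity of C₃ in E₀ is displayed on p. 20; for the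
dressed pencil it is part of the same unprinted uniformity G-ne9p2-5), and the met ∕ large-field half ((w5b),
`DressedSigmaRoute`).

v1.1 (generation 27; APPEND-ONLY + DOC-ONLY: every v1 declaration byte-identical in statement and proof).  (i) The two
wording loci ruled DOCFIX-LOW by typer R-T93 (ii) (title; `attachedPart_locE_le`) now carry the qualifier «at the level of the
bookkeeping … R-t4r2-Q2 NOT thereby met for NE1′».  (ii) NEW §4 [arith] — THE DRESSED CLAUSE IS PRINT'S CLAUSE WITH A
FACTOR-4 ROOM (owner memo g26 v1.3 (R12)): at the pencil radius `ϱ⋆ := max 2 (A₀/A₁)` (`0 < A₁`) one has `2 ≤ ϱ⋆`,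
`A₀ ≤ ϱ⋆·A₁` and `A₀ + ϱ⋆·A₁ ≤ 2·A₀ + 2·A₁` (`pencilConst_le`), so §2's clause `hsmall` at the pencil constant follows from
print's «ε₁ sufficiently small» taken at TWICE the undressed plus TWICE the attached constant (`pencilClause_of_two_two`), and —
when the attached (2.38)-slope does not exceed the undressed intercept, `A₁ ≤ A₀` (attached size ≤ undressed size, `D₀ ≤ E₀`:
the source window is small) — from print's clause at the UNDRESSED constant `A₀ = C₃ε₁` with a factor-4 room,
`4·A₀·e^{b+1}K₀νc₁ ≤ 1` (`pencilClause_of_printClause_four`); `attachedPart_locE_le_of_printClause_four` is §2 with the radius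
and its two side conditions ELIMINATED in favour of that clause — so the binder (B5) of the small-field bracket is of print's
KIND exactly (a numerical room on «ε₁ sufficiently small»; «κ sufficiently large» `hrate` is table-size-free and unchanged).
Nothing else changes: (B1) `hhol`∕`hm` (now asked on the ball of radius `ϱ⋆`), (B3) `hL3` (affine, UNPRINTED = G-ne9p2-5),
(B4) geometry, and the step-link stay displayed binders ∕ readings.

v1.2 (generation 27; APPEND-ONLY).  §4b: the SHARP room under `A₁ ≤ A₀` is 3, not 4 — `pencilConst_le_three`
(`A₀ + ϱ⋆A₁ ≤ 3A₀`, equality at `A₁ = A₀`), `pencilClause_of_printClause_three`, `attachedPart_locE_le_of_printClause_three`; v1.1's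
factor 4 is the loss of the two-two route and stays a true (non-sharp) room.

HONEST FRAMING.  [arith] + one by-name kernel composition over SHAPES; nothing of Bałaban's densities instantiated; the loci are
TYPE∕CONTEXT (B13 p. 20 C₃'s formula and (2.38), p. 21 the ½E₀ clause — reproduced with [cite] tags in `B13Resummation` ∕
`T4ActivityLipschitz`); ABSOLUTE RULE honoured.  NE1′ NOT printed, NOT proved; spine PROVED 0∕9; count 9 unchanged.  Rung (B)+1 on
ONE finite four-torus — NOT infinite volume, NOT a mass gap, NOT OS on ℝ⁴, NOT Clay.  HONEST DEPENDENCY: continuum YM on T⁴ ⇐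
BetaPertH ∧ nine spine estimates (0/9 proved); BetaPertH ⇐ (D1) ∧ (D4) ∧ CAP+tail; G-an2-4 gates asym, D1 and NE2/3/4.
-/

noncomputable section

namespace Summit.QuantumFields.BalabanUV.T4Continuum.NE1p.DressedSmallFieldInduction

open Metric Set Complex
open scoped BigOperators
open Literature.MathematicalPhysics.QuantumFieldTheory.Balaban1983to89.B13FamilySum (Ineq126 VolBound Ineq227)
open Literature.MathematicalPhysics.QuantumFieldTheory.Balaban1983to89.B13Resummation (locE)
open Summit.QuantumFields.BalabanUV.T4Continuum.NE1p.DressedSmallFieldPencil (regenPart_locE_le)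

variable {Dom Cube : Type*} [DecidableEq Dom] [DecidableEq Cube] [Fintype Dom]
variable (ι : Dom → Dom → Prop) [DecidableRel ι]

/-! ## §1 Arithmetic of the affine majorant along a table-strength pencil -/

/-- [arith] For `ϱ ≥ 2`, `0 ≤ A₁` and `A₀ ≤ ϱ·A₁`: `(A₀ + ϱ·A₁)/(ϱ − 1) ≤ 4·A₁` — the constant of a (2.38)-majorant AFFINE in
the strength of the attached table, divided by the pencil's Cauchy denominator, is bounded by four times its SLOPE (the part
proportional to the attached table), the intercept `A₀` (the undressed part ∝ E₀) leaking only through `A₀/ϱ ≤ A₁`. -/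
theorem affine_div_le {A₀ A₁ ϱ : ℝ} (hϱ : 2 ≤ ϱ) (hA₁ : 0 ≤ A₁) (hA₀ : A₀ ≤ ϱ * A₁) :
    (A₀ + ϱ * A₁) / (ϱ - 1) ≤ 4 * A₁ := by
  have hϱ1 : 0 < ϱ - 1 := by linarith
  rw [div_le_iff₀ hϱ1]
  nlinarith

/-! ## §2 THE TABLE-STRENGTH PENCIL CARRIES THE INDUCTION: the attached part of the output is LINEAR in the attached table's
(2.38)-slope, under print's clause at the DOUBLED dressed constant — no source-window loss -/

/-- **THE ATTACHED PART OF THE DRESSED SMALL-FIELD OUTPUT IS PROPORTIONAL TO THE ATTACHED TABLE** (kernel;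
`DressedSmallFieldPencil.regenPart_locE_le` BY NAME on the TABLE-STRENGTH pencil `s ↦ 𝐕_k + s·𝐖` of radius `ϱ`, then §1).
Binders: B13's geometry and footprint locality; the dressed activities `act s Z` complex differentiable in the STRENGTH `s` on
`‖s‖ < ϱ` polymer by polymer (`hhol`) under a strength-free majorant `m Z` (`hm`) of the (2.38)-shape with a constant AFFINE in
the radius, `m Z ≤ (A₀ + ϱ·A₁)·e^{−R d(Z)}` (`hL3` — Lemma 3's constant is linear in the table size: intercept `A₀` ∝ the
undressed size E₀, slope `A₁` ∝ the attached table's size; printed TYPE [Balaban1988RGII] p. 20 «C₃ =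
2(L+2)⁴O(1)2E₀C₁α₄⁻¹α₆⁻¹M^q exp C₂κ₁», linear in E₀; the dressed instance is the binder (B3) = GAPS G-ne9p2-5); the pencil
radius chosen with `2 ≤ ϱ` and `A₀ ≤ ϱ·A₁` (as large as the intercept-to-slope ratio); and the one-run clauses at the constant
`A₀ + ϱ·A₁` (`hrate`, `hsmall` — for `ϱ = A₀/A₁` this is print's «ε₁ sufficiently small» with the undressed constant DOUBLED,
cf. `T4ActivityLipschitz` §1's doubled majorant). Conclusion: `‖E[𝐕_k + 𝐖](X) − E[𝐕_k](X)‖ ≤ 4·(e ν c₁ K₀²)·A₁·e^{−r₁ d(X)}` —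
LINEAR in the slope `A₁`, hence in the attached table's size, with (2.41)'s decay and WITHOUT any charge on the
source-analyticity window: the (1.18)-type induction for the observable-attached terms closes under a clause of print's own kind
(«O(1)·C₃′ε₁ ≤ ½» with `C₃′` the slope constant), μ-UNIFORMLY (R-t4r2-Q2) — v1.1 QUALIFIER (typer R-T93 (ii), reader
X103): «closes» AT THE LEVEL OF THE BOOKKEEPING — this is ONE step; the induction is §3's arithmetic over an abstract size
sequence whose per-step contraction `hstep` is a HYPOTHESIS there, discharged step by step only modulo (B1)∕(B3)∕(B4)∕(B5) AT
EVERY STEP with a K-free per-unit constant `C′` and the step-link READING «attached OUTPUT of step k = attached TABLE of step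
k + 1» (incl. the rate restoration output-rate `r₁` ↦ next input-rate `R`, which is part of (B3) = Lemma 3's own gain, printed
TYPE p. 21 under the closing condition `(1 − 10δ)ℓ = 1` of `B13Resummation.smallness_exponent_of_R22gen`); R-t4r2-Q2 is NOT
thereby met for NE1′. -/
theorem attachedPart_locE_le [Std.Refl ι] [Std.Symm ι] {cubes reach : Dom → Finset Cube} {d : Dom → ℝ} {m : Dom → ℝ}
    {act : ℂ → Dom → ℂ} {A₀ A₁ R r₁ κ₀ K₀ c₁ c b ν dX ϱ : ℝ} {X : Finset Cube}
    (hloc : ∀ Z Z', ι Z' Z → ∃ q ∈ reach Z, q ∈ cubes Z')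
    (hreach : ∀ Z, ((reach Z).card : ℝ) ≤ ν * (cubes Z).card)
    (hd : ∀ Z, 0 ≤ d Z) (hA₀ : 0 ≤ A₀) (hA₁ : 0 ≤ A₁) (hK₀ : 0 ≤ K₀) (hc₁ : 0 ≤ c₁) (hν : 0 ≤ ν) (hκ₀ : 0 ≤ κ₀)
    (hr₁ : 0 ≤ r₁) (hc : 0 ≤ c) (hb : r₁ * c ≤ b)
    (h126 : Ineq126 (Finset.univ : Finset Dom) cubes d κ₀ K₀)
    (hvol : VolBound (Finset.univ : Finset Dom) cubes d c₁)
    (h227 : Ineq227 (Finset.univ : Finset Dom) cubes d X dX c)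
    (hrate : r₁ + 2 * κ₀ + 2 ≤ R) (hsmall : (A₀ + ϱ * A₁) * Real.exp (b + 1) * K₀ * ν * c₁ ≤ 1) (hX : X.Nonempty)
    (hhol : ∀ Z, cubes Z ⊆ X → DifferentiableOn ℂ (fun s => act s Z) (ball (0 : ℂ) ϱ))
    (hm : ∀ s ∈ ball (0 : ℂ) ϱ, ∀ Z, cubes Z ⊆ X → ‖act s Z‖ ≤ m Z)
    (hL3 : ∀ Z, cubes Z ⊆ X → m Z ≤ (A₀ + ϱ * A₁) * Real.exp (-(R * d Z))) (hϱ : 2 ≤ ϱ) (hϱA : A₀ ≤ ϱ * A₁) :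
    ‖locE ι cubes (act 1) X - locE ι cubes (act 0) X‖ ≤
      4 * (Real.exp 1 * ν * c₁ * K₀ ^ 2) * A₁ * Real.exp (-(r₁ * dX)) := by
  have hA : 0 ≤ A₀ + ϱ * A₁ := add_nonneg hA₀ (mul_nonneg (by linarith) hA₁)
  have h := regenPart_locE_le ι hloc hreach hd hA hK₀ hc₁ hν hκ₀ hr₁ hc hb h126 hvol h227 hrate hsmall hX hhol hm hL3
    (by linarith)
  have hfac : 0 ≤ Real.exp 1 * ν * c₁ * K₀ ^ 2 * Real.exp (-(r₁ * dX)) := by positivity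
  calc ‖locE ι cubes (act 1) X - locE ι cubes (act 0) X‖
      ≤ Real.exp 1 * ν * c₁ * K₀ ^ 2 * (A₀ + ϱ * A₁) * Real.exp (-(r₁ * dX)) / (ϱ - 1) := h
    _ = (Real.exp 1 * ν * c₁ * K₀ ^ 2 * Real.exp (-(r₁ * dX))) * ((A₀ + ϱ * A₁) / (ϱ - 1)) := by ring
    _ ≤ (Real.exp 1 * ν * c₁ * K₀ ^ 2 * Real.exp (-(r₁ * dX))) * (4 * A₁) :=
        mul_le_mul_of_nonneg_left (affine_div_le hϱ hA₁ hϱA) hfac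
    _ = 4 * (Real.exp 1 * ν * c₁ * K₀ ^ 2) * A₁ * Real.exp (-(r₁ * dX)) := by ring

/-! ## §3 THE INDUCTION CLAUSE: the attached size reproduces under «O(1)·C₃′·ε₁ ≤ θ», μ-uniformly -/

/-- **REPRODUCTION OF THE ATTACHED SIZE** [arith]: if the slope is `A₁ = C′·D₀` (the (2.38)-constant per unit of attached table
size `C′` — printed TYPE `C₃/E₀·ε₁` — times the attached size `D₀`) and print's clause type `4·(e ν c₁ K₀²)·C′ ≤ θ` holds, then
the attached part of the output is `≤ θ·D₀·e^{−r₁ d(X)}`: the observable-attached size REPRODUCES with the factor `θ` (print: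
«O(1)C₃ε₁ ≤ ½E₀» reproduces E₀ with ½) at EVERY step with the SAME source window — the K-uniformity the dressed run needs. -/
theorem attachedSize_reproduces {E ν c₁ K₀ C' D₀ θ r₁ dX : ℝ}
    (hE : E ≤ 4 * (Real.exp 1 * ν * c₁ * K₀ ^ 2) * (C' * D₀) * Real.exp (-(r₁ * dX))) (hD₀ : 0 ≤ D₀)
    (hclause : 4 * (Real.exp 1 * ν * c₁ * K₀ ^ 2) * C' ≤ θ) :
    E ≤ θ * D₀ * Real.exp (-(r₁ * dX)) := by
  refine hE.trans ?_
  have h := mul_le_mul_of_nonneg_right (mul_le_mul_of_nonneg_right hclause hD₀) (Real.exp_nonneg (-(r₁ * dX)))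
  calc 4 * (Real.exp 1 * ν * c₁ * K₀ ^ 2) * (C' * D₀) * Real.exp (-(r₁ * dX))
      = 4 * (Real.exp 1 * ν * c₁ * K₀ ^ 2) * C' * D₀ * Real.exp (-(r₁ * dX)) := by ring
    _ ≤ θ * D₀ * Real.exp (-(r₁ * dX)) := h

/-- **K-UNIFORMITY OF THE ATTACHED SIZES ALONG THE TRAJECTORY** [arith]: nonnegative sizes obeying `D (k+1) ≤ θ·D k` with
`θ ≤ 1` stay below the initial one, `D k ≤ D 0`, for EVERY `k` — no dependence on the number of steps (contrast
`T4TrajectoryDensityDressedLoop` §8's `size_lb_noContraction`, where a per-step charge on the source window forced the admissible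
source strength to shrink with `K`). -/
theorem attachedSize_uniform {D : ℕ → ℝ} {θ : ℝ} (hθ1 : θ ≤ 1) (hD : ∀ k, 0 ≤ D k)
    (hstep : ∀ k, D (k + 1) ≤ θ * D k) : ∀ k, D k ≤ D 0 := by
  intro k
  induction k with
  | zero => exact le_rfl
  | succ k ih => exact (hstep k).trans ((mul_le_of_le_one_left (hD k) hθ1).trans ih)

/-! ## §4 (v1.1) THE DRESSED CLAUSE IS PRINT'S CLAUSE WITH A FACTOR-4 ROOM: the pencil radius `ϱ⋆ = max 2 (A₀/A₁)` and
the elimination of `hϱ` ∕ `hϱA` ∕ `hsmall` in favour of «ε₁ sufficiently small» at the undressed constant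

Scope (t4-ref2 pass 76, C-t4r2-354 (iii)): of the numerical clauses [Balaban1988RGII] p. 20 carries — «(L + 2)⁴O(1)ε₂ ≤ ½»,
«2(L + 2)⁴O(1)ε₂ exp 5κ ≤ 1», «½(κ₁ − 1) ≥ 2Lκ», «(LM)⁴α₀, (LM)⁴α₁, (LM)⁴α₄, (LM)⁴γ₂ … bounded … by 1» (LOCI, TYPE) — only
the two ε₂-clauses read the table size (ε₂ ∝ E₀ through the (2.18) radii; `C₃ε₁ = 2(L + 2)⁴O(1)ε₂`), and they scale by the
same factor `(E₀ + D₀)/E₀` under dressing (`≤ 2` when `D₀ ≤ E₀`; `≤ 4` along the pencil at `ϱ⋆`, `pencilConst_le`); BOTH sit inside Lemma 3's proof (the first sums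
`n ≥ 1`, the second yields (2.37)) and are therefore part of (B3)'s re-run (G-ne9p2-5); the KP-side clause of p. 21 («for κ
sufficiently large, and ε₁ sufficiently small», (2.39) → (2.40)) has the SAME SHAPE `C₃ε₁·e^{5κ}·O(1) ≤ 1` — typed in
`B13Resummation.norm_locE_le_of_small`'s letters as `A·e^{b+1}K₀νc₁ ≤ 1`, i.e. `hsmall` here — and scales alike; the κ₁- and
α-clauses are table-size-free, unchanged by dressing, and stay with the B13 node's «κ ∕ M large» binder (memo g26 (R6)).  Page 19 (LOCI, TYPE: «and denoting
ε₂ = 2E₀ε₁C₁α₄⁻¹α₆⁻¹M^q exp C₂κ₁», «We have used the assumption ε₂ ≤ 1», «For simplicity let us assume that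
exp(−(1/20)γ₂ε₁²/γ²) ≤ ε₂») adds one more size-reading clause of the same kind, «ε₂ ≤ 1» (same room), and one LOWER bound on ε₂,
which dressing can only relax (ε₂ grows with the table size, E₀ ↦ E₀ + D₀, and along the pencil). -/

/-- [arith] The pencil radius `ϱ⋆ := max 2 (A₀/A₁)` is at least `2` (§2's `hϱ`). -/
theorem two_le_pencilRadius (A₀ A₁ : ℝ) : 2 ≤ max 2 (A₀ / A₁) :=
  le_max_left _ _

/-- [arith] At the pencil radius `ϱ⋆ := max 2 (A₀/A₁)` with a LIVE slope `0 < A₁`, the intercept is dominated by radius times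
slope, `A₀ ≤ ϱ⋆·A₁` (§2's `hϱA`: the radius is at least the intercept-to-slope ratio). -/
theorem intercept_le_pencilRadius_mul {A₀ A₁ : ℝ} (hA₁ : 0 < A₁) : A₀ ≤ max 2 (A₀ / A₁) * A₁ :=
  calc A₀ = A₀ / A₁ * A₁ := (div_mul_cancel₀ A₀ hA₁.ne').symm
    _ ≤ max 2 (A₀ / A₁) * A₁ := mul_le_mul_of_nonneg_right (le_max_right _ _) hA₁.le

/-- [arith] **THE PENCIL CONSTANT AT `ϱ⋆` IS AT MOST TWICE THE UNDRESSED PLUS TWICE THE ATTACHED CONSTANT**: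
`A₀ + ϱ⋆·A₁ ≤ 2·A₀ + 2·A₁` for `ϱ⋆ = max 2 (A₀/A₁)`, `0 < A₁` (indeed `ϱ⋆·A₁ = max (2A₁) A₀ ≤ 2A₁ + A₀`; at `ϱ⋆ = A₀/A₁`
the pencil constant is the «DOUBLED constant» `2A₀` of §2's docstring, reader X103 (F7)). -/
theorem pencilConst_le {A₀ A₁ : ℝ} (hA₀ : 0 ≤ A₀) (hA₁ : 0 < A₁) :
    A₀ + max 2 (A₀ / A₁) * A₁ ≤ 2 * A₀ + 2 * A₁ := by
  rcases le_total 2 (A₀ / A₁) with h | h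
  · rw [max_eq_right h, div_mul_cancel₀ A₀ hA₁.ne']
    linarith
  · rw [max_eq_left h]
    linarith

/-- [arith] **§2's CLAUSE FROM PRINT'S CLAUSE AT TWICE-UNDRESSED-PLUS-TWICE-ATTACHED**: if «ε₁ sufficiently small» holds at
the constant `2·A₀ + 2·A₁` — `(2A₀ + 2A₁)·e^{b+1}K₀νc₁ ≤ 1` in `B13Resummation.norm_locE_le_of_small`'s letters — then §2's
`hsmall` holds at the pencil radius `ϱ⋆ = max 2 (A₀/A₁)`.  (`E` abbreviates the nonnegative clause factor `e^{b+1}K₀νc₁`.) -/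
theorem pencilClause_of_two_two {A₀ A₁ E : ℝ} (hA₀ : 0 ≤ A₀) (hA₁ : 0 < A₁) (hE : 0 ≤ E)
    (h22 : (2 * A₀ + 2 * A₁) * E ≤ 1) : (A₀ + max 2 (A₀ / A₁) * A₁) * E ≤ 1 :=
  (mul_le_mul_of_nonneg_right (pencilConst_le hA₀ hA₁) hE).trans h22

/-- [arith] **THE DRESSED CLAUSE IS PRINT'S CLAUSE WITH A FACTOR-4 ROOM** (owner memo g26 v1.3 (R12)): when the attached
(2.38)-slope does not exceed the undressed intercept, `A₁ ≤ A₀` (attached size `D₀` ≤ undressed size `E₀` — the source window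
is small), print's «ε₁ sufficiently small» at the UNDRESSED constant `A₀ = C₃ε₁` taken with a factor `4`, `4·A₀·E ≤ 1`,
implies §2's `hsmall` at the pencil radius `ϱ⋆`.  So (B5) of the small-field bracket is a clause of print's KIND exactly —
[Balaban1988RGII] p. 21 «ε₁ sufficiently small» (TYPE) with a numerical room — not a new smallness mechanism. -/
theorem pencilClause_of_printClause_four {A₀ A₁ E : ℝ} (hA₀ : 0 ≤ A₀) (hA₁ : 0 < A₁) (hle : A₁ ≤ A₀) (hE : 0 ≤ E)
    (h4 : 4 * A₀ * E ≤ 1) : (A₀ + max 2 (A₀ / A₁) * A₁) * E ≤ 1 :=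
  pencilClause_of_two_two hA₀ hA₁ hE (by nlinarith)

/-- **THE ATTACHED PART OF THE DRESSED SMALL-FIELD OUTPUT UNDER PRINT'S CLAUSE WITH A FACTOR-4 ROOM** (kernel; §2 at the
pencil radius `ϱ⋆ = max 2 (A₀/A₁)` with `hϱ`, `hϱA`, `hsmall` DISCHARGED by §4's arithmetic): for a live attached slope
`0 < A₁ ≤ A₀`, under B13's geometry, «κ sufficiently large» (`hrate`, table-size-free) and «ε₁ sufficiently small» AT THE
UNDRESSED CONSTANT WITH A FACTOR-4 ROOM (`h4 : 4·A₀·e^{b+1}·K₀·ν·c₁ ≤ 1`), (E1)∕(E2) along the table-strength pencil on the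
ball of radius `ϱ⋆` (`hhol`∕`hm` — under (B1)'s exp-linear (2.14)-shape the activities are entire in the strength, so the radius
costs nothing there) and the affine (2.38)-majorant at that radius (`hL3` — binder (B3) = GAPS G-ne9p2-5, UNPRINTED, read with
its E₀-linearity): `‖E[𝐕_k + 𝐖](X) − E[𝐕_k](X)‖ ≤ 4·(e ν c₁ K₀²)·A₁·e^{−r₁ d(X)}`.  The case `A₁ = 0` (no attached table) is
not covered by this corollary and not needed (the attached part is then `0` by (B1)); the case `A₀ < A₁` is served by
`pencilClause_of_two_two` + §2 directly. -/
theorem attachedPart_locE_le_of_printClause_four [Std.Refl ι] [Std.Symm ι] {cubes reach : Dom → Finset Cube} {d : Dom → ℝ}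
    {m : Dom → ℝ} {act : ℂ → Dom → ℂ} {A₀ A₁ R r₁ κ₀ K₀ c₁ c b ν dX : ℝ} {X : Finset Cube}
    (hloc : ∀ Z Z', ι Z' Z → ∃ q ∈ reach Z, q ∈ cubes Z')
    (hreach : ∀ Z, ((reach Z).card : ℝ) ≤ ν * (cubes Z).card)
    (hd : ∀ Z, 0 ≤ d Z) (hA₀ : 0 ≤ A₀) (hA₁ : 0 < A₁) (hle : A₁ ≤ A₀) (hK₀ : 0 ≤ K₀) (hc₁ : 0 ≤ c₁) (hν : 0 ≤ ν)
    (hκ₀ : 0 ≤ κ₀) (hr₁ : 0 ≤ r₁) (hc : 0 ≤ c) (hb : r₁ * c ≤ b)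
    (h126 : Ineq126 (Finset.univ : Finset Dom) cubes d κ₀ K₀)
    (hvol : VolBound (Finset.univ : Finset Dom) cubes d c₁)
    (h227 : Ineq227 (Finset.univ : Finset Dom) cubes d X dX c)
    (hrate : r₁ + 2 * κ₀ + 2 ≤ R) (h4 : 4 * A₀ * (Real.exp (b + 1) * K₀ * ν * c₁) ≤ 1) (hX : X.Nonempty)
    (hhol : ∀ Z, cubes Z ⊆ X → DifferentiableOn ℂ (fun s => act s Z) (ball (0 : ℂ) (max 2 (A₀ / A₁))))
    (hm : ∀ s ∈ ball (0 : ℂ) (max 2 (A₀ / A₁)), ∀ Z, cubes Z ⊆ X → ‖act s Z‖ ≤ m Z)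
    (hL3 : ∀ Z, cubes Z ⊆ X → m Z ≤ (A₀ + max 2 (A₀ / A₁) * A₁) * Real.exp (-(R * d Z))) :
    ‖locE ι cubes (act 1) X - locE ι cubes (act 0) X‖ ≤
      4 * (Real.exp 1 * ν * c₁ * K₀ ^ 2) * A₁ * Real.exp (-(r₁ * dX)) := by
  have hE : 0 ≤ Real.exp (b + 1) * K₀ * ν * c₁ := by positivity
  have hsmall' := pencilClause_of_printClause_four hA₀ hA₁ hle hE h4
  have hsmall : (A₀ + max 2 (A₀ / A₁) * A₁) * Real.exp (b + 1) * K₀ * ν * c₁ ≤ 1 := by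
    simpa only [mul_assoc] using hsmall'
  exact attachedPart_locE_le ι hloc hreach hd hA₀ hA₁.le hK₀ hc₁ hν hκ₀ hr₁ hc hb h126 hvol h227 hrate hsmall hX hhol hm
    hL3 (two_le_pencilRadius A₀ A₁) (intercept_le_pencilRadius_mul hA₁)

/-! ## §4b (v1.2) THE SHARP ROOM IS 3: under `A₁ ≤ A₀` the pencil constant at `ϱ⋆` is at most `3·A₀` (attained at `A₁ = A₀`,
`ϱ⋆ = 2`), so print's clause with a factor-3 room already gives §2's `hsmall` — v1.1's factor 4 is the loss of the two-two route
(`2A₀ + 2A₁ ≤ 4A₀`); both rooms are of print's KIND, the wall's «factor-4 room» stays TRUE and is merely not sharp -/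

/-- [arith] **SHARP PENCIL CONSTANT**: for `0 < A₁ ≤ A₀`, `A₀ + ϱ⋆·A₁ ≤ 3·A₀` at `ϱ⋆ = max 2 (A₀/A₁)` (case `A₀/A₁ ≤ 2`:
`A₀ + 2A₁ ≤ 3A₀`; case `A₀/A₁ ≥ 2`: `2A₀ ≤ 3A₀`); equality at `A₁ = A₀`. -/
theorem pencilConst_le_three {A₀ A₁ : ℝ} (hA₁ : 0 < A₁) (hle : A₁ ≤ A₀) : A₀ + max 2 (A₀ / A₁) * A₁ ≤ 3 * A₀ := by
  rcases le_total 2 (A₀ / A₁) with h | h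
  · rw [max_eq_right h, div_mul_cancel₀ A₀ hA₁.ne']
    linarith
  · rw [max_eq_left h]
    linarith

/-- [arith] **THE DRESSED CLAUSE IS PRINT'S CLAUSE WITH A FACTOR-3 ROOM** (sharp form of `pencilClause_of_printClause_four`):
`0 < A₁ ≤ A₀` and `3·A₀·E ≤ 1` give §2's `hsmall` at the pencil radius `ϱ⋆`. -/
theorem pencilClause_of_printClause_three {A₀ A₁ E : ℝ} (hA₁ : 0 < A₁) (hle : A₁ ≤ A₀) (hE : 0 ≤ E)
    (h3 : 3 * A₀ * E ≤ 1) : (A₀ + max 2 (A₀ / A₁) * A₁) * E ≤ 1 :=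
  (mul_le_mul_of_nonneg_right (pencilConst_le_three hA₁ hle) hE).trans h3

/-- **THE ATTACHED PART UNDER PRINT'S CLAUSE WITH THE SHARP FACTOR-3 ROOM** (kernel; `attachedPart_locE_le` at `ϱ⋆` with
`hϱ`∕`hϱA`∕`hsmall` discharged by §4∕§4b): as `attachedPart_locE_le_of_printClause_four` with `h4` replaced by
`h3 : 3·A₀·(e^{b+1}K₀νc₁) ≤ 1`. [folklore] -/
theorem attachedPart_locE_le_of_printClause_three [Std.Refl ι] [Std.Symm ι] {cubes reach : Dom → Finset Cube}
    {d : Dom → ℝ} {m : Dom → ℝ} {act : ℂ → Dom → ℂ} {A₀ A₁ R r₁ κ₀ K₀ c₁ c b ν dX : ℝ} {X : Finset Cube}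
    (hloc : ∀ Z Z', ι Z' Z → ∃ q ∈ reach Z, q ∈ cubes Z')
    (hreach : ∀ Z, ((reach Z).card : ℝ) ≤ ν * (cubes Z).card)
    (hd : ∀ Z, 0 ≤ d Z) (hA₀ : 0 ≤ A₀) (hA₁ : 0 < A₁) (hle : A₁ ≤ A₀) (hK₀ : 0 ≤ K₀) (hc₁ : 0 ≤ c₁) (hν : 0 ≤ ν)
    (hκ₀ : 0 ≤ κ₀) (hr₁ : 0 ≤ r₁) (hc : 0 ≤ c) (hb : r₁ * c ≤ b)
    (h126 : Ineq126 (Finset.univ : Finset Dom) cubes d κ₀ K₀)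
    (hvol : VolBound (Finset.univ : Finset Dom) cubes d c₁)
    (h227 : Ineq227 (Finset.univ : Finset Dom) cubes d X dX c)
    (hrate : r₁ + 2 * κ₀ + 2 ≤ R) (h3 : 3 * A₀ * (Real.exp (b + 1) * K₀ * ν * c₁) ≤ 1) (hX : X.Nonempty)
    (hhol : ∀ Z, cubes Z ⊆ X → DifferentiableOn ℂ (fun s => act s Z) (ball (0 : ℂ) (max 2 (A₀ / A₁))))
    (hm : ∀ s ∈ ball (0 : ℂ) (max 2 (A₀ / A₁)), ∀ Z, cubes Z ⊆ X → ‖act s Z‖ ≤ m Z)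
    (hL3 : ∀ Z, cubes Z ⊆ X → m Z ≤ (A₀ + max 2 (A₀ / A₁) * A₁) * Real.exp (-(R * d Z))) :
    ‖locE ι cubes (act 1) X - locE ι cubes (act 0) X‖ ≤
      4 * (Real.exp 1 * ν * c₁ * K₀ ^ 2) * A₁ * Real.exp (-(r₁ * dX)) := by
  have hE : 0 ≤ Real.exp (b + 1) * K₀ * ν * c₁ := by positivity
  have hsmall' := pencilClause_of_printClause_three hA₁ hle hE h3
  have hsmall : (A₀ + max 2 (A₀ / A₁) * A₁) * Real.exp (b + 1) * K₀ * ν * c₁ ≤ 1 := by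
    simpa only [mul_assoc] using hsmall'
  exact attachedPart_locE_le ι hloc hreach hd hA₀ hA₁.le hK₀ hc₁ hν hκ₀ hr₁ hc hb h126 hvol h227 hrate hsmall hX hhol hm
    hL3 (two_le_pencilRadius A₀ A₁) (intercept_le_pencilRadius_mul hA₁)

end Summit.QuantumFields.BalabanUV.T4Continuum.NE1p.DressedSmallFieldInduction

end
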